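import Mathlib
import HarnessLib
import Literature.NumberTheory.GaloisRepresentations.LocalKroneckerWeberInertiaProofs

/-!
# `EisensteinProModularSeed` (stmt-Langlands-12920), line `descend-raise-basechange`, stub S2
# `stub_levelRaisedEisensteinNewformQ` — II. Inertia at `p`: the Serre weight of `1 ⊕ η̄`

Support file (`--supports stmt-Langlands-12920`).  Everything here is PROVED (no named fact, no
definition):

* `monoidHom_units_zmod_primePow_eq_pow` — homomorphisms `(ℤ/p^m)ˣ → κˣ` into a field of
  characteristic `p` (`p` odd) are powers `c ↦ (c mod p)^j`, `j < p - 1` (cyclicity of `(ℤ/p^m)ˣ`,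
  no `p`-torsion in `κˣ`, the `(p-1)`-st roots of unity);
* `ringHom_padicInt_apply` — every ring map `ℤ_p → κ` (`char κ = p`) is reduction mod `p`;
* `exists_primesAbove_inertia_eq_absGaloisRestrict` — `res : Γ_{ℚ_w} → Γ_ℚ` maps the local inertia
  group ONTO `I_{𝔓₀}` for the prime `𝔓₀` of the chosen embedding (tree: Neukirch II (9.6));
* `exists_weight_of_window` — for `p` odd and a continuous unit-valued `η : Γ_ℚ → ℚ̄_pˣ` in the
  WINDOW (`η̄ ≠ 1`, `η̄ ω ≠ 1` on the inertia groups above `p`) there is `k`, `2 ≤ k ≤ p - 2`, with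
  `η̄ = ω^{k-1}` on `I_{𝔓₀}` — Serre's "characters of the tame inertia that extend to `G_p` are
  powers of the fundamental character of level one" (Serre 1972, §1, Prop. 3), PROVED from the
  tree's local Kronecker–Weber theorem in inertia form
  (`adicCompletion_rat_exists_eq_comp_cyclotomicCharacter_of_mem_absInertia`).

References: J.-P. Serre, *Propriétés galoisiennes des points d'ordre fini des courbes elliptiques*,
Invent. Math. 15 (1972), §1, Prop. 3; *Local Fields*, XIV §7. [folklore]
-/

set_option linter.dupNamespace false -- project-wide option (lakefile weak.linter.dupNamespace); `Summit.Langlands.Langlands` is the mandated namespace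

noncomputable section

namespace Summit.Langlands.Langlands.Theorems.SkinnerWilesDefectOne.EisensteinProModularSeed

open Literature.NumberTheory.GaloisRepresentations
open NumberField IsDedekindDomain IsLocalRing Field

section GroupCore

/-- **Homomorphisms `(ℤ/p^m)ˣ → κˣ` into a field of characteristic `p` are powers of the
tautological character** (`p` odd, `m ≥ 1`): there is `j < p - 1` with
`g(c) = (c mod p)^j` for all `c`.  (`(ℤ/p^m)ˣ` is cyclic; `κˣ` has no `p`-torsion, so a generator
goes to a `(p-1)`-st root of unity, and these are the powers of the image of a generator of
`(ℤ/p)ˣ`.) [folklore] -/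
theorem monoidHom_units_zmod_primePow_eq_pow {p : ℕ} [hp : Fact p.Prime] (hp2 : p ≠ 2)
    {κ : Type*} [Field κ] [CharP κ p] {m : ℕ} (hm : 0 < m) (g : (ZMod (p ^ m))ˣ →* κˣ) :
    ∃ j : ℕ, j < p - 1 ∧ ∀ c : (ZMod (p ^ m))ˣ,
      (g c : κ) = (ZMod.castHom (dvd_refl p) κ
        ((ZMod.unitsMap (dvd_pow_self p hm.ne') c : (ZMod p)ˣ) : ZMod p)) ^ j := by
  classical
  haveI : NeZero (p ^ m) := ⟨pow_ne_zero _ hp.out.ne_zero⟩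
  -- `p`-power torsion in `κˣ` is trivial
  have htors : ∀ (y : κˣ) (r : ℕ), y ^ p ^ r = 1 → y = 1 := by
    intro y r h
    have h1 : ((y : κ) - 1) ^ p ^ r = 0 := by
      rw [sub_pow_char_pow, one_pow, ← Units.val_pow_eq_pow_val, h, Units.val_one, sub_self]
    exact Units.ext (sub_eq_zero.mp (pow_eq_zero_iff (pow_ne_zero r hp.out.ne_zero) |>.mp h1))
  -- a generator `γ` of the cyclic group `(ℤ/p^m)ˣ`
  haveI hcyc : IsCyclic (ZMod (p ^ m))ˣ := ZMod.isCyclic_units_of_prime_pow p hp.out hp2 m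
  obtain ⟨γ, hγ⟩ := IsCyclic.exists_generator (α := (ZMod (p ^ m))ˣ)
  set r : (ZMod (p ^ m))ˣ →* (ZMod p)ˣ := ZMod.unitsMap (dvd_pow_self p hm.ne') with hr
  set ω : (ZMod p)ˣ →* κˣ := Units.map (ZMod.castHom (dvd_refl p) κ).toMonoidHom with hω
  have hωval : ∀ a : (ZMod p)ˣ, (ω a : κ) = ZMod.castHom (dvd_refl p) κ (a : ZMod p) := fun a => rfl
  set ζ := r γ with hζ_def
  set x := g γ with hx_def
  -- `x ^ (p - 1) = 1`
  have hcard : Fintype.card (ZMod (p ^ m))ˣ = p ^ (m - 1) * (p - 1) := by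
    rw [ZMod.card_units_eq_totient, Nat.totient_prime_pow hp.out hm]
  have hx : x ^ (p - 1) = 1 := by
    apply htors _ (m - 1)
    rw [← pow_mul, mul_comm, ← hcard, hx_def, ← map_pow, pow_card_eq_one, map_one]
  -- `ζ` generates `(ℤ/p)ˣ`, so `ω ζ` has order `p - 1`
  have hζ : ∀ y : (ZMod p)ˣ, y ∈ Subgroup.zpowers ζ := by
    intro y
    obtain ⟨c, rfl⟩ := ZMod.unitsMap_surjective (dvd_pow_self p hm.ne') y
    obtain ⟨n, rfl⟩ := Subgroup.mem_zpowers_iff.mp (hγ c)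
    exact ⟨n, by rw [hζ_def, map_zpow]⟩
  have hordζ : orderOf ζ = p - 1 := by
    rw [orderOf_eq_card_of_forall_mem_zpowers hζ, Nat.card_eq_fintype_card, ZMod.card_units]
  have hωinj : Function.Injective ω := by
    intro a b h
    have h' : (ω a : κ) = (ω b : κ) := by rw [h]
    rw [hωval, hωval] at h'
    exact Units.ext ((ZMod.castHom (dvd_refl p) κ).injective h')
  have hordω : orderOf (ω ζ) = p - 1 := by rw [orderOf_injective ω hωinj, hordζ]
  have hp1 : 0 < p - 1 := by have := hp.out.two_le; omega
  haveI : NeZero (p - 1) := ⟨hp1.ne'⟩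
  -- the `(p-1)`-st roots of unity of `κ` are the powers of `ω ζ`
  have hx_mem : x ∈ Subgroup.zpowers (ω ζ) := by
    have hle : Subgroup.zpowers (ω ζ) ≤ rootsOfUnity (p - 1) κ := by
      rw [Subgroup.zpowers_le, mem_rootsOfUnity, ← hordω, pow_orderOf_eq_one]
    have heq : Subgroup.zpowers (ω ζ) = rootsOfUnity (p - 1) κ :=
      Subgroup.eq_of_le_of_card_ge hle (by
        rw [Nat.card_zpowers, hordω]; exact card_rootsOfUnity (R := κ) (k := p - 1))
    rw [heq, mem_rootsOfUnity]
    exact hx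
  obtain ⟨j, hj, hjx⟩ : ∃ j : ℕ, j < p - 1 ∧ (ω ζ) ^ j = x := by
    have hfin : IsOfFinOrder (ω ζ) := orderOf_pos_iff.mp (by rw [hordω]; exact hp1)
    obtain ⟨n, hn⟩ := (hfin.mem_powers_iff_mem_zpowers.mpr hx_mem : x ∈ Submonoid.powers (ω ζ))
    change ω ζ ^ n = x at hn
    refine ⟨n % (p - 1), Nat.mod_lt _ hp1, ?_⟩
    rw [← hordω, pow_mod_orderOf, hn]
  refine ⟨j, hj, fun c => ?_⟩
  obtain ⟨n, rfl⟩ : ∃ n : ℕ, γ ^ n = c := by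
    obtain ⟨n, hn⟩ := (mem_powers_iff_mem_zpowers.mpr (hγ c) : c ∈ Submonoid.powers γ)
    exact ⟨n, hn⟩
  have h1 : g (γ ^ n) = (ω (r (γ ^ n))) ^ j := by
    rw [map_pow, map_pow, map_pow, ← hx_def, ← hζ_def, ← hjx, ← pow_mul, ← pow_mul, mul_comm]
  have h2 := congrArg (fun u : κˣ => (u : κ)) h1
  simp only [Units.val_pow_eq_pow_val, hωval] at h2
  exact h2

/-- **Every ring homomorphism `ℤ_p → κ` into a ring of characteristic `p` is reduction modulo `p`**:
`φ x = (x mod p)` (`PadicInt.zmodRepr`). [folklore] -/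
theorem ringHom_padicInt_apply {p : ℕ} [hp : Fact p.Prime] {κ : Type*} [Ring κ] [CharP κ p]
    (φ : ℤ_[p] →+* κ) (x : ℤ_[p]) : φ x = (x.zmodRepr : κ) := by
  have h := PadicInt.sub_zmodRepr_mem x
  rw [PadicInt.maximalIdeal_eq_span_p, Ideal.mem_span_singleton] at h
  obtain ⟨y, hy⟩ := h
  have : x = (x.zmodRepr : ℤ_[p]) + (p : ℤ_[p]) * y := by rw [← hy]; ring
  have key : φ x = φ ((x.zmodRepr : ℤ_[p]) + (p : ℤ_[p]) * y) := by rw [← this]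
  rw [key, map_add, map_mul, map_natCast, map_natCast, CharP.cast_eq_zero κ p, zero_mul, add_zero]

end GroupCore

/-! ### Inertia at `p`: local–global transport and the exponent of `η̄` -/

section InertiaAtP

open scoped Valued

variable (p : ℕ) [hp : Fact p.Prime]

/-- On `ℚ̄_p`, `v x < 1` iff `‖x‖ < 1`. [folklore] -/
theorem v_lt_one_iff_norm_lt_one' (x : PadicAlgCl p) : Valued.v x < 1 ↔ ‖x‖ < 1 := by
  rw [PadicAlgCl.valuation_def, ← NNReal.coe_lt_coe, coe_nnnorm, NNReal.coe_one]

/-- **Local and global inertia at a finite place of `ℚ`.**  For the prime `𝔓₀` of `\bar ℤ` cut out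
by the chosen embedding `ℚ̄ → \bar ℚ_w`, the restriction map `res : Γ_{ℚ_w} → Γ_ℚ` maps the local
inertia group `I_{ℚ_w}` ONTO the inertia group `I_{𝔓₀}` (tree theorems
`exists_absGaloisRestrict_eq_of_mem_inertia`, `absGaloisRestrict_mem_inertia_of_mem_absInertia`;
Neukirch, *Algebraic Number Theory*, II (9.6)). [folklore] -/
theorem exists_primesAbove_inertia_eq_absGaloisRestrict (w : HeightOneSpectrum (𝓞 ℚ)) :
    ∃ 𝔓 ∈ w.primesAbove,
      (∀ τ ∈ 𝔓.inertia (absoluteGaloisGroup ℚ), ∃ σ ∈ absInertia (w.adicCompletion ℚ),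
          absGaloisRestrict ℚ (w.adicCompletion ℚ) σ = τ) ∧
      (∀ σ ∈ absInertia (w.adicCompletion ℚ),
          absGaloisRestrict ℚ (w.adicCompletion ℚ) σ ∈ 𝔓.inertia (absoluteGaloisGroup ℚ)) := by
  have hw := adicCompletion_valuation_le_one_iff ℚ w
  have hO := norm_algebraMap_ringOfIntegers_le_one ℚ w
  have hvlt := norm_algebraMap_ringOfIntegers_lt_one_iff ℚ w
  have hd : DenseRange (algebraMap ℚ (w.adicCompletion ℚ)) :=
    IsDedekindDomain.HeightOneSpectrum.denseRange_algebraMap (K := ℚ) (v := w)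
  obtain ⟨𝔓, h𝔓⟩ := exists_ideal_forall_mem_iff_spectralNorm_lt_one ℚ (w.adicCompletion ℚ) hO
  have h𝔓v : 𝔓 ∈ w.primesAbove := mem_primesAbove_of_forall_mem_iff w hvlt 𝔓 h𝔓
  refine ⟨𝔓, h𝔓v, fun τ hτ => ?_, fun σ hσ => ?_⟩
  · exact exists_absGaloisRestrict_eq_of_mem_inertia hw hd hO
      (exists_norm_algebraMap_adicCompletion_lt_one ℚ w) 𝔓 h𝔓
      (HeightOneSpectrum.isMaximal_of_mem_primesAbove h𝔓v) hτ
  · exact absGaloisRestrict_mem_inertia_of_mem_absInertia hw hO 𝔓 h𝔓 hσ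

/-- The ring map `ℤ_p → 𝒪_{ℚ̄_p}` (through `ℚ_p ⊆ ℚ̄_p`) exists. [folklore] -/
theorem exists_ringHom_padicInt_valuationSubring :
    ∃ ψ : ℤ_[p] →+* (Valued.v : Valuation (PadicAlgCl p) NNReal).valuationSubring,
      ∀ x : ℤ_[p], ((ψ x : (Valued.v : Valuation (PadicAlgCl p) NNReal).valuationSubring) :
        PadicAlgCl p) = algebraMap ℚ_[p] (PadicAlgCl p) (x : ℚ_[p]) :=
  ⟨((algebraMap ℚ_[p] (PadicAlgCl p)).comp PadicInt.Coe.ringHom).codRestrict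
    (Valued.v : Valuation (PadicAlgCl p) NNReal).valuationSubring.toSubring (fun x => by
      change algebraMap ℚ_[p] (PadicAlgCl p) (x : ℚ_[p]) ∈
        (Valued.v : Valuation (PadicAlgCl p) NNReal).valuationSubring
      rw [Valuation.mem_valuationSubring_iff, PadicAlgCl.valuation_def, ← NNReal.coe_le_coe, coe_nnnorm,
        NNReal.coe_one]
      change ‖((x : ℚ_[p]) : PadicAlgCl p)‖ ≤ 1
      rw [PadicAlgCl.norm_extends]
      exact PadicInt.norm_le_one x), fun _ => rfl⟩

/-- `p` lies in the maximal ideal of `𝒪_{ℚ̄_p}`. [folklore] -/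
theorem natCast_prime_mem_maximalIdeal :
    ((p : ℕ) : (Valued.v : Valuation (PadicAlgCl p) NNReal).valuationSubring) ∈
      maximalIdeal ((Valued.v : Valuation (PadicAlgCl p) NNReal).valuationSubring) := by
  rw [Valuation.mem_maximalIdeal_iff]
  change Valued.v ((p : ℕ) : PadicAlgCl p) < 1
  rw [PadicAlgCl.valuation_p, one_div]
  exact inv_lt_one_of_one_lt₀ (by exact_mod_cast hp.out.one_lt)

/-- The residue field of `𝒪_{ℚ̄_p}` has characteristic `p`. [folklore] -/
theorem charP_residueField :
    CharP (ResidueField ((Valued.v : Valuation (PadicAlgCl p) NNReal).valuationSubring)) p :=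
  (CharP.charP_iff_prime_eq_zero hp.out).mpr (by
    rw [← map_natCast (residue ((Valued.v : Valuation (PadicAlgCl p) NNReal).valuationSubring))]
    exact (residue_eq_zero_iff _).mpr (natCast_prime_mem_maximalIdeal p))

/-- **The exponent of a residual character on inertia at `p`** (Serre 1972, Prop. 3: a character of
the tame inertia with values in `\bar 𝔽_pˣ` that extends to the decomposition group is a power
`ω^j` of the fundamental character of level one — the mod `p` cyclotomic character), in the tree's
language and PROVED from the local Kronecker–Weber theorem in inertia form
(`adicCompletion_rat_exists_eq_comp_cyclotomicCharacter_of_mem_absInertia`): for `p` odd and a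
continuous unit-valued `η : Γ_ℚ → ℚ̄_pˣ` there is `j ≤ p - 2` with `η(τ) ≡ χ_p(τ)^j` for all `τ`
in the inertia group of the prime `𝔓₀ ∣ p` of the chosen embedding; if moreover `η̄ ≠ 1` and
`η̄ ω ≠ 1` on the inertia groups above `p` (the WINDOW), then `1 ≤ j ≤ p - 3`, i.e. `j = k - 1`
with `2 ≤ k ≤ p - 2`. [folklore] -/
theorem exists_weight_of_window :
    ∀ (p : ℕ) [Fact p.Prime], p ≠ 2 → ∀ (η : Field.absoluteGaloisGroup ℚ →ₜ* (PadicAlgCl p)ˣ),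
      (∀ τ, Valued.v ((η τ : (PadicAlgCl p)ˣ) : PadicAlgCl p) = 1) →
      ∀ (w : IsDedekindDomain.HeightOneSpectrum (NumberField.RingOfIntegers ℚ)),
      (p : NumberField.RingOfIntegers ℚ) ∈ w.asIdeal →
      (∀ 𝔓 ∈ w.primesAbove,
        (∃ σ ∈ 𝔓.inertia (Field.absoluteGaloisGroup ℚ),
          ¬ Valued.v (((η σ : (PadicAlgCl p)ˣ) : PadicAlgCl p) - 1) < 1) ∧
        (∃ σ ∈ 𝔓.inertia (Field.absoluteGaloisGroup ℚ),
          ¬ Valued.v (((η σ : (PadicAlgCl p)ˣ) : PadicAlgCl p) *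
            (algebraMap (Padic p) (PadicAlgCl p)
              (((Literature.NumberTheory.GaloisRepresentations.GaloisRep.cyclotomicCharacter ℚ p σ).val :
                PadicInt p) : Padic p)) - 1) < 1)) →
      ∃ k : ℕ, 2 ≤ k ∧ k + 2 ≤ p ∧ ∃ 𝔓 ∈ w.primesAbove, ∀ σ ∈ 𝔓.inertia (Field.absoluteGaloisGroup ℚ),
        Valued.v (((η σ : (PadicAlgCl p)ˣ) : PadicAlgCl p) -
          algebraMap (Padic p) (PadicAlgCl p)
            (((Literature.NumberTheory.GaloisRepresentations.GaloisRep.cyclotomicCharacter ℚ p σ).val :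
              PadicInt p) : Padic p) ^ (k - 1)) < 1 := by
  intro p hp hp2 η hunit w hpw hwin
  classical
  haveI : NeZero p := ⟨hp.out.ne_zero⟩
  have hwp : ((Rat.HeightOneSpectrum.primesEquiv w : Nat.Primes) : ℕ) = p := by
    change Rat.HeightOneSpectrum.natGenerator w = p
    rw [← Nat.prime_dvd_prime_iff_eq (Rat.HeightOneSpectrum.prime_natGenerator w) hp.out,
      Rat.HeightOneSpectrum.natGenerator_dvd_iff,
      ← map_natCast (Rat.IsIntegralClosure.intEquiv (𝓞 ℚ)) p, Ideal.apply_mem_of_equiv_iff]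
    exact hpw
  obtain ⟨𝔓, h𝔓w, hlift, hres⟩ := exists_primesAbove_inertia_eq_absGaloisRestrict w
  -- the valuation ring `A` of `ℚ̄_p`, its residue field `κ` (characteristic `p`)
  set A : ValuationSubring (PadicAlgCl p) := (Valued.v : Valuation (PadicAlgCl p) NNReal).valuationSubring
    with hA
  haveI : CharP (ResidueField A) p := charP_residueField p
  -- `η` as a homomorphism to the units of the residue field
  have hηU : ∀ τ, (η τ : (PadicAlgCl p)ˣ) ∈ A.unitGroup := fun τ =>
    (Valuation.mem_unitGroup_iff (v := (Valued.v : Valuation (PadicAlgCl p) NNReal))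
      (x := (η τ : (PadicAlgCl p)ˣ))).mpr (hunit τ)
  set ηU : absoluteGaloisGroup ℚ →* A.unitGroup := η.toMonoidHom.codRestrict A.unitGroup hηU with hηU_def
  set Λ₀ : absoluteGaloisGroup ℚ →* (ResidueField A)ˣ := A.unitGroupToResidueFieldUnits.comp ηU
    with hΛ₀
  set Λ : absoluteGaloisGroup (w.adicCompletion ℚ) →* (ResidueField A)ˣ :=
    Λ₀.comp (absGaloisRestrict ℚ (w.adicCompletion ℚ)).toMonoidHom with hΛ
  have hker₀ : ∀ τ, Λ₀ τ = 1 ↔ Valued.v (((η τ : (PadicAlgCl p)ˣ) : PadicAlgCl p) - 1) < 1 := by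
    intro τ
    change A.unitGroupToResidueFieldUnits (ηU τ) = 1 ↔ _
    rw [← MonoidHom.mem_ker, ValuationSubring.ker_unitGroupToResidueFieldUnits, Subgroup.mem_comap,
      Subgroup.coe_subtype, ValuationSubring.mem_principalUnitGroup_iff]
    change A.valuation (((η τ : (PadicAlgCl p)ˣ) : PadicAlgCl p) - 1) < 1 ↔ _
    exact ((Valuation.isEquiv_valuation_valuationSubring _).lt_one_iff_lt_one).symm
  have hΛval : ∀ τ, ((Λ₀ τ : (ResidueField A)ˣ) : ResidueField A) =
      residue A (A.unitGroupMulEquiv (ηU τ) : A) := fun τ => rfl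
  have hcoeη : ∀ τ, ((A.unitGroupMulEquiv (ηU τ) : A) : PadicAlgCl p) =
      ((η τ : (PadicAlgCl p)ˣ) : PadicAlgCl p) := fun τ => rfl
  -- open kernel
  have hopen : IsOpen ((Λ.ker : Subgroup (absoluteGaloisGroup (w.adicCompletion ℚ))) :
      Set (absoluteGaloisGroup (w.adicCompletion ℚ))) := by
    have hset : ((Λ.ker : Subgroup (absoluteGaloisGroup (w.adicCompletion ℚ))) :
        Set (absoluteGaloisGroup (w.adicCompletion ℚ))) =
        (fun σ => ((η (absGaloisRestrict ℚ (w.adicCompletion ℚ) σ) : (PadicAlgCl p)ˣ) :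
          PadicAlgCl p) - 1) ⁻¹' Metric.ball 0 1 := by
      ext σ
      rw [SetLike.mem_coe, MonoidHom.mem_ker, Set.mem_preimage, mem_ball_zero_iff,
        ← v_lt_one_iff_norm_lt_one']
      exact hker₀ _
    rw [hset]
    refine Metric.isOpen_ball.preimage ?_
    exact (Units.continuous_val.comp (η.continuous.comp
      (absGaloisRestrict ℚ (w.adicCompletion ℚ)).continuous)).sub continuous_const
  have hcomm : ∀ a b, Λ a * Λ b = Λ b * Λ a := fun a b => mul_comm _ _
  obtain ⟨m, hm, g, hg⟩ :=
    adicCompletion_rat_exists_eq_comp_cyclotomicCharacter_of_mem_absInertia p w hwp Λ hopen hcomm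
  obtain ⟨j, hj, hgj⟩ := monoidHom_units_zmod_primePow_eq_pow hp2 hm g
  -- two ring maps `ℤ_p → κ`: reduction of the inclusion, and through `ℤ/p^m → ℤ/p`
  obtain ⟨ψ, hψ⟩ := exists_ringHom_padicInt_valuationSubring p
  set φ₁ : ℤ_[p] →+* ResidueField A := (residue A).comp ψ with hφ₁
  set φ₂ : ℤ_[p] →+* ResidueField A :=
    (ZMod.castHom (dvd_refl p) (ResidueField A)).comp
      ((ZMod.castHom (dvd_pow_self p hm.ne') (ZMod p)).comp (PadicInt.toZModPow m)) with hφ₂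
  have hφ : ∀ x, φ₂ x = φ₁ x := fun x => by
    rw [ringHom_padicInt_apply φ₁, ringHom_padicInt_apply φ₂]
  -- the key congruence on the local inertia group
  have hkey : ∀ σ ∈ absInertia (w.adicCompletion ℚ),
      Valued.v (((η (absGaloisRestrict ℚ (w.adicCompletion ℚ) σ) : (PadicAlgCl p)ˣ) : PadicAlgCl p) -
        algebraMap ℚ_[p] (PadicAlgCl p)
          (((GaloisRep.cyclotomicCharacter (w.adicCompletion ℚ) p σ).val : ℤ_[p]) : ℚ_[p]) ^ j) < 1 := by
    intro σ hσ
    set u := GaloisRep.cyclotomicCharacter (w.adicCompletion ℚ) p σ with hu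
    have h1 : ((Λ σ : (ResidueField A)ˣ) : ResidueField A) = (φ₂ (u : ℤ_[p])) ^ j := by
      rw [hg σ hσ, hgj]
      congr 1
    have h2 : ((Λ σ : (ResidueField A)ˣ) : ResidueField A) =
        residue A (A.unitGroupMulEquiv (ηU (absGaloisRestrict ℚ (w.adicCompletion ℚ) σ)) : A) := rfl
    rw [h2, hφ, hφ₁, RingHom.comp_apply, ← map_pow, ← sub_eq_zero, ← map_sub,
      residue_eq_zero_iff, Valuation.mem_maximalIdeal_iff] at h1
    convert h1 using 2
    push_cast
    rw [hcoeη, hψ]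
  -- transport to the global inertia group `I_{𝔓₀}`
  haveI : NeZero ((p : ℕ) : ℚ) := NeZero.charZero
  have hkey' : ∀ τ ∈ 𝔓.inertia (absoluteGaloisGroup ℚ),
      Valued.v (((η τ : (PadicAlgCl p)ˣ) : PadicAlgCl p) -
        algebraMap ℚ_[p] (PadicAlgCl p)
          (((GaloisRep.cyclotomicCharacter ℚ p τ).val : ℤ_[p]) : ℚ_[p]) ^ j) < 1 := by
    intro τ hτ
    obtain ⟨σ, hσ, rfl⟩ := hlift τ hτ
    rw [cyclotomicCharacter_absGaloisRestrict]
    exact hkey σ hσ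
  -- `χ_p^(p-1) ≡ 1` on `Γ_ℚ`
  have hFermat : ∀ τ : absoluteGaloisGroup ℚ,
      Valued.v (algebraMap ℚ_[p] (PadicAlgCl p)
          (((GaloisRep.cyclotomicCharacter ℚ p τ).val : ℤ_[p]) : ℚ_[p]) ^ (p - 1) - 1) < 1 := by
    intro τ
    set u := GaloisRep.cyclotomicCharacter ℚ p τ with hu
    set φ₃ : ℤ_[p] →+* ResidueField A :=
      (ZMod.castHom (dvd_refl p) (ResidueField A)).comp PadicInt.toZMod with hφ₃
    have hφ₃₁ : ∀ x, φ₃ x = φ₁ x := fun x => by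
      rw [ringHom_padicInt_apply φ₁, ringHom_padicInt_apply φ₃]
    have hne : PadicInt.toZMod (u : ℤ_[p]) ≠ 0 :=
      (Units.map (PadicInt.toZMod (p := p)).toMonoidHom u).ne_zero
    have h1 : (φ₁ (u : ℤ_[p])) ^ (p - 1) = 1 := by
      rw [← hφ₃₁, hφ₃, RingHom.comp_apply, ← map_pow, ZMod.pow_card_sub_one_eq_one hne, map_one]
    rw [hφ₁, RingHom.comp_apply, ← map_pow, ← (residue A).map_one, ← sub_eq_zero, ← map_sub,
      residue_eq_zero_iff, Valuation.mem_maximalIdeal_iff] at h1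
    convert h1 using 2
    push_cast
    rw [hψ]
  -- the window pins `1 ≤ j ≤ p - 3`
  obtain ⟨⟨τ₁, hτ₁, hτ₁'⟩, ⟨τ₂, hτ₂, hτ₂'⟩⟩ := hwin 𝔓 h𝔓w
  have hj0 : j ≠ 0 := by
    rintro rfl
    apply hτ₁'
    simpa using hkey' τ₁ hτ₁
  have hjp : j ≠ p - 2 := by
    intro hjeq
    apply hτ₂'
    set c := algebraMap ℚ_[p] (PadicAlgCl p)
      (((GaloisRep.cyclotomicCharacter ℚ p τ₂).val : ℤ_[p]) : ℚ_[p]) with hc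
    have hcle : Valued.v c ≤ 1 := by
      rw [hc, ← hψ]
      exact (Valuation.mem_valuationSubring_iff _ _).mp (SetLike.coe_mem _)
    have h1 := hkey' τ₂ hτ₂
    rw [hjeq] at h1
    have h2 := hFermat τ₂
    have h3 : Valued.v ((((η τ₂ : (PadicAlgCl p)ˣ) : PadicAlgCl p) - c ^ (p - 2)) * c) < 1 := by
      rw [map_mul]
      exact mul_lt_one_of_nonneg_of_lt_one_left zero_le h1 hcle
    have h4 := Valuation.map_add_lt _ h3 h2
    convert h4 using 2
    have hp3 : p - 1 = (p - 2) + 1 := by have := hp.out.two_le; omega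
    rw [hp3, pow_succ]
    ring
  refine ⟨j + 1, by omega, by omega, 𝔓, h𝔓w, fun σ hσ => ?_⟩
  rw [Nat.add_sub_cancel]
  exact hkey' σ hσ

end InertiaAtP

end Summit.Langlands.Langlands.Theorems.SkinnerWilesDefectOne.EisensteinProModularSeed
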